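import Literature.NumberTheory.LFunctions.CriticalLineTwoThirdsTheoremAProofs
import Literature.NumberTheory.LFunctions.CoincidentPairJointCounts
import Literature.NumberTheory.LFunctions.ZeroPairSecondMomentHolds
import HarnessLib

/-!
# RH-FREE — «nothing here bears on the truth of RH»: zeta zeros in a narrow vertical box and Montgomery's simple-zero method without RH — Baluyot–Goldston–Suriajaya–Turnage-Butterbaugh 2025 (arXiv:2501.14545) Theorems 1–2, Goldston–Suriajaya 2025 (arXiv:2511.20059) Theorem 2, Goldston–Suriajaya 2026 (arXiv:2603.28104) Theorem 1 and Lemma 1 — typed, and PROVED / DISCHARGED in this tree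

Topic `Literature/NumberTheory/LFunctions` (namespace `Literature.NumberTheory.LFunctions`; paper
objects under `GLSS2026` (pair counts, as in the tree) and `BGSTB2025` (the box `B_b`)). Cell
`rh-columns/lit`, unit `rh-lit-frontier-1` (gen 9; cross-ladder literature layer D-0088(4)). These three
preprints are the citation-graph neighbours that [AF26] (Alpöge–Furman, arXiv:2608.13637v2, the unit's
source) names as having "posed the question answered here" ([AF26] acknowledgements and refs
[BGSTB25], [GS25], [GS26]); they were untyped except for [BGSTB25]'s corrected Montgomery Theorem
(`baluyotEtAl2025_montgomeryTheorem`, `UnconditionalPairCorrelation.lean`) and [GS26] Theorem 2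
(`CoincidentPairJointCounts.lean`, cell `rh-split`, with part (i) =
`GLSS2026.two_mul_zetaZeroCount_sub_coincidentPairCount_le` of `AlternativeHypothesisConsequences.lean`).

STATUS NOTES (no endorsement; triage-typing). [BGSTB25] = arXiv:2501.14545v2 (Nov 2025), preprint,
unrefereed as far as the seat could determine; its §2 "MT" corrects the error terms of the authors'
2024 Acta Arith. Theorem 1 (recorded in `UnconditionalPairCorrelation.lean`). [GS25] = arXiv:2511.20059v2
(Feb 2026), a 10-page "exposé" (the authors' word), preprint. [GS26] = arXiv:2603.28104v1 (Mar 2026),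
preprint; its Theorem 2 (iii) is credited to Soundararajan (private communication). All three are
CONDITIONAL results (narrow-box hypotheses / a bound for the same-ordinate pair count) obtained by the
pair-correlation method; every one of their conclusions about `ζ` that is typed below is, in THIS tree,
either an elementary counting theorem or a consequence of the kernel theorems
`AlpogeFurman2026_simple_critical_dyadic_holds` / `…_MT_dyadic_holds` ([AF26] Theorem A for the typed
model, `CriticalLineTwoThirds*Proofs.lean`, gens 6–8), which make the narrow-box hypotheses unnecessary.
That is a statement about this tree's kernel, not about the sources. Nothing here bears on the truth of RH.

## Dictionary (all objects are the tree's)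

* `N(T)` = `zetaZeroCount T` (zeros `0 < γ ≤ T` with multiplicity); the papers' `N(B_b)`, `N_s(B_b)`,
  `N₀(B_b)`, `N₀ˢ(B_b)` ([BGSTB25] §1.3: zeros with `T < γ ≤ 2T` in the box, resp. simple, on the
  line, simple and on the line, "we count zeros with multiplicity") are, UNDER the papers' hypothesis
  that every zero with `T < γ ≤ 2T` lies in `B_b`, the dyadic differences `N(2T) − N(T)`,
  `N_s(2T) − N_s(T)` (`simpleZeroCount`), `N₀(2T) − N₀(T)` (`criticalZeroCount`),
  `N⁽¹⁾(2T) − N⁽¹⁾(T)` (`simpleCriticalZeroCount`); the typed statements use the dyadic differences.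
* `Σ_{ρ,ρ': 0<γ,γ'≤T, γ=γ'} 1` (pairs with multiplicity) = `GLSS2026.coincidentPairCount T` (`N⊛(T)`).
* `B_b` ([BGSTB25] §1.3, [GS25] Theorem 3, [GS26] Theorem 1): `|σ − ½| < b/(2 log T)`, `T < t ≤ 2T` —
  `BGSTB2025.InNarrowBox b T` (every zero of `ζ` with `T < Im ρ ≤ 2T` has `|Re ρ − ½| < b/(2 log T)`).

## Contents and status

* §1 dictionary/dyadic lemmas (proved): the four counts on a window `T < γ ≤ T'` as filtered sums over
  the distinct zeros of `zetaZeroBox 0 T'`; `N_s(T') − N_s(T) ≥ N⁽¹⁾(T') − N⁽¹⁾(T)`,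
  `N₀(T') − N₀(T) ≥ N⁽¹⁾(T') − N⁽¹⁾(T)`; `(1 ± δ)(T/2π) log T` brackets for `N(2T) − N(T)`
  (from the tree's `AlpogeFurman2026.abs_dyadic_count_sub_le`).
* §2 the Montgomery–Taylor constant to eight decimals (proved, kernel arithmetic only):
  `1.3274992 < c_MT⁻¹ < 1.32749935`, sharpening the tree's six-decimal
  `montgomeryTaylorInvConstant_bounds` (needed because [BGSTB25] prints `0.67250064 < 2 − c_MT⁻¹ =
  0.6725007…`).
* §3 [GS26] hypothesis in the PRINTED normalisation `N⊛(T) ≤ (C + o(1))(T/2π) log T`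
  (`GLSS2026.CoincidentPairBoundPrinted`) ⟺ the tree's `GLSS2026.CoincidentPairBound` (normalised by
  `N(T)`), proved; `C ≥ 1` is forced (`GLSS2026.one_le_of_coincidentPairBound`); **[GS26] Lemma 1,
  second display: there IS such a `C` unconditionally — PROVED** (`goldstonSuriajaya2026_lemma1`, from the
  tree's discharged GLSS second-moment statement `glss2026_dsec2_holds` via
  `GLSS2026.exists_eventually_card_closePairs_le`; the sources cite Goldston–Montgomery 1987 /
  Gallagher–Mueller 1978 / Fujii 1974); **[GS25] Theorem 2 PROVED** (`goldstonSuriajaya2025_theorem2`: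
  `≥ 2 − C` simple, `≥ 2 − C` on the line, and `≥ 3 − 2C` simple-and-on-the-line when `C < 3/2` —
  all three from [GS26] Theorem 2 (i), which gives the better `2 − C` for the last).
* §4 narrow boxes: **[BGSTB25] Theorem 1**, **[GS26] Theorem 1**, **[BGSTB25] Theorem 2** typed as
  named facts `baluyotEtAl2025_theorem1`, `goldstonSuriajaya2026_theorem1`, `baluyotEtAl2025_theorem2`
  (hypotheses complete, constants as printed) and **DISCHARGED** (`…_holds`): the conclusions hold in
  this tree with the box hypotheses unused.

NOT typed: [BGSTB25] Table 1 (other `b`), §§3–6 (Tsang kernel, proofs); [GS26] Lemma 1 first display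
(general `0 ≤ h ≤ T`) (the tree has the fixed-window form `GLSS2026.exists_eventually_card_closePairs_le`),
Lemma 2 (Aryan's Fejér-kernel asymptotic — `Aryan2019` material lives in `AlternativeHypothesisConsequences.lean`
Part C), Lemma 3 (Selberg's Fejér-kernel perturbation bound); [GS25] §§2–3 (exposition), Theorem 4
(= GLSS 2025/2026, typed in `AlternativeHypothesisConsequences.lean`).

## References

* [BaluyotEtAl2025] S. A. C. Baluyot, D. A. Goldston, A. I. Suriajaya, C. L. Turnage-Butterbaugh, *Pair
  correlation of zeros of the Riemann zeta function I: proportions of simple zeros and critical zeros*,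
  arXiv:2501.14545v2: §1.3 (definition of `B_b`, `N(B_b)`, `N_s(B_b)`, `N₀(B_b)`, `N₀ˢ(B_b)`; Theorem 1,
  three displays; Remark 2; Theorem 2, two displays), §1.1 (the `67.25%` / `34.5%` sentence).
* [GoldstonSuriajaya2025] D. A. Goldston, A. I. Suriajaya, *Zeta zeros on the critical line*,
  arXiv:2511.20059v2: §4 (the decomposition "(key)" of the same-ordinate pair count; Theorem 2 with its
  proof, incl. the remark that `C ≥ 1` is forced), §5 Theorem 3 (= [BaluyotEtAl2025] with `b = 0.3185`).
* [GoldstonSuriajaya2026] D. A. Goldston, A. I. Suriajaya, *Zeta zeros in a narrow vertical box*,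
  arXiv:2603.28104v1: Theorem 1 (§1), Theorem 2 (§4), Lemma 1 (§5, two displays; "This lemma and its
  proof may be found in [GM87]"), §8 (proof of Theorem 1: `C = 4/3` under the box hypothesis).
* [AlpogeFurman2026] L. Alpöge, R. Furman, arXiv:2608.13637v2: Theorem A (p. 1); acknowledgements and
  references [BGSTB25], [GS25], [GS26] (pp. 43–44).
* [Titchmarsh1986] E. C. Titchmarsh, *The theory of the Riemann zeta-function*, 2nd ed., §9.1, Thm. 9.4, §10.1.
-/

noncomputable section

open Filter Real Finset
open scoped Topology

namespace Literature.NumberTheory.LFunctions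

/-! ## §1 Dictionary and dyadic lemmas -/

namespace BGSTB2025

/-- The distinct zeros of the box `0 < Im ρ ≤ T'` as a `Finset`. [folklore] -/
def boxFinset (T' : ℝ) : Finset ℂ := (zetaZeroBox_finite 0 T').toFinset

/-- Membership in `boxFinset`. [cite: Titchmarsh1986, §9.1] -/
theorem mem_boxFinset {T' : ℝ} {ρ : ℂ} : ρ ∈ boxFinset T' ↔ ρ ∈ zetaZeroBox 0 T' :=
  Set.Finite.mem_toFinset _

/-- Multiplicities are `≥ 1` on the box. [cite: Titchmarsh1986, §9.1] -/
theorem one_le_order_of_mem {T' : ℝ} {ρ : ℂ} (h : ρ ∈ boxFinset T') : 1 ≤ riemannZetaZeroOrder ρ := by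
  have := DiophantineGeometry.riemannZetaZeroOrder_pos_of_mem_zetaZeroBox (mem_boxFinset.1 h)
  omega

/-- For `T ≤ T'`: `ρ ∈ zetaZeroBox 0 T ↔ ρ ∈ zetaZeroBox 0 T' ∧ Im ρ ≤ T`. [cite: Titchmarsh1986, §9.1] -/
theorem mem_zetaZeroBox_iff_of_le {T T' : ℝ} (h : T ≤ T') (ρ : ℂ) :
    ρ ∈ zetaZeroBox 0 T ↔ ρ ∈ zetaZeroBox 0 T' ∧ ρ.im ≤ T := by
  constructor
  · rintro ⟨h0, h1, h2, h3, h4⟩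
    exact ⟨⟨h0, h1, h2, h3, h4.trans h⟩, h4⟩
  · rintro ⟨⟨h0, h1, h2, h3, -⟩, h4⟩
    exact ⟨h0, h1, h2, h3, h4⟩

/-- `N(T) = Σ_{ρ ∈ box(T'), Im ρ ≤ T} m(ρ)` for `T ≤ T'`. [cite: Titchmarsh1986, §9.1] -/
theorem zetaZeroCount_eq_sum_filter {T T' : ℝ} (h : T ≤ T') :
    (zetaZeroCount T : ℤ) = ∑ ρ ∈ (boxFinset T').filter (fun ρ ↦ ρ.im ≤ T), riemannZetaZeroOrder ρ := by
  classical
  rw [zetaZeroCount_eq_finsum]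
  have hset : zetaZeroBox 0 T = ↑((boxFinset T').filter fun ρ ↦ ρ.im ≤ T) := by
    ext ρ
    rw [mem_zetaZeroBox_iff_of_le h, Finset.coe_filter, Set.mem_setOf_eq, mem_boxFinset]
  rw [hset, finsum_mem_coe_finset]

/-- `N_s(T) = #{ρ ∈ box(T') : m(ρ) = 1, Im ρ ≤ T}` for `T ≤ T'`. [cite: BaluyotEtAl2025, §1.3 (N_s)] -/
theorem simpleZeroCount_eq_card_filter {T T' : ℝ} (h : T ≤ T') :
    simpleZeroCount T =
      ((boxFinset T').filter fun ρ ↦ riemannZetaZeroOrder ρ = 1 ∧ ρ.im ≤ T).card := by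
  classical
  have hset : {ρ ∈ zetaZeroBox 0 T | riemannZetaZeroOrder ρ = 1} =
      ↑((boxFinset T').filter fun ρ ↦ riemannZetaZeroOrder ρ = 1 ∧ ρ.im ≤ T) := by
    ext ρ
    simp only [Set.mem_setOf_eq, Finset.coe_filter, mem_boxFinset, mem_zetaZeroBox_iff_of_le h ρ]
    tauto
  unfold simpleZeroCount
  rw [hset, Set.ncard_coe_finset]

/-- `N⁽¹⁾(T) = #{ρ ∈ box(T') : Re ρ = ½, m(ρ) = 1, Im ρ ≤ T}` for `T ≤ T'`. [cite: BaluyotEtAl2025, §1.3 (N₀ˢ)] -/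
theorem simpleCriticalZeroCount_eq_card_filter {T T' : ℝ} (h : T ≤ T') :
    simpleCriticalZeroCount T =
      ((boxFinset T').filter fun ρ ↦ (ρ.re = 1 / 2 ∧ riemannZetaZeroOrder ρ = 1) ∧ ρ.im ≤ T).card := by
  classical
  have hset : {ρ ∈ zetaZeroBox (1 / 2) T | ρ.re = 1 / 2 ∧ riemannZetaZeroOrder ρ = 1} =
      ↑((boxFinset T').filter fun ρ ↦ (ρ.re = 1 / 2 ∧ riemannZetaZeroOrder ρ = 1) ∧ ρ.im ≤ T) := by
    ext ρ
    simp only [Set.mem_setOf_eq, Finset.coe_filter, mem_boxFinset]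
    constructor
    · rintro ⟨⟨h0, -, h2, h3, h4⟩, h5, h6⟩
      exact ⟨⟨h0, by rw [h5]; norm_num, h2, h3, h4.trans h⟩, ⟨h5, h6⟩, h4⟩
    · rintro ⟨⟨h0, -, h2, h3, -⟩, ⟨h5, h6⟩, h4⟩
      exact ⟨⟨h0, by rw [h5], h2, h3, h4⟩, h5, h6⟩
  unfold simpleCriticalZeroCount
  rw [hset, Set.ncard_coe_finset]

/-- `N₀(T) = Σ_{ρ ∈ box(T'), Re ρ = ½, Im ρ ≤ T} m(ρ)` for `T ≤ T'`. [cite: Titchmarsh1986, §10.1] -/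
theorem criticalZeroCount_eq_sum_filter {T T' : ℝ} (h : T ≤ T') :
    (criticalZeroCount T : ℤ) =
      ∑ ρ ∈ (boxFinset T').filter (fun ρ ↦ ρ.re = 1 / 2 ∧ ρ.im ≤ T), riemannZetaZeroOrder ρ := by
  classical
  have hset : {ρ ∈ zetaZeroBox (1 / 2) T | ρ.re = 1 / 2} =
      ↑((boxFinset T').filter fun ρ ↦ ρ.re = 1 / 2 ∧ ρ.im ≤ T) := by
    ext ρ
    simp only [Set.mem_setOf_eq, Finset.coe_filter, mem_boxFinset]
    constructor
    · rintro ⟨⟨h0, -, h2, h3, h4⟩, h5⟩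
      exact ⟨⟨h0, by rw [h5]; norm_num, h2, h3, h4.trans h⟩, h5, h4⟩
    · rintro ⟨⟨h0, -, h2, h3, -⟩, h5, h4⟩
      exact ⟨⟨h0, by rw [h5], h2, h3, h4⟩, h5⟩
  rw [intCast_criticalZeroCount, hset, finsum_mem_coe_finset]

/-- **Dyadic counts as window sums.** For `T ≤ T'`: `N(T') − N(T) = Σ_{T < Im ρ ≤ T'} m(ρ)`.
[cite: Titchmarsh1986, §9.1] -/
theorem zetaZeroCount_sub_eq {T T' : ℝ} (h : T ≤ T') :
    (zetaZeroCount T' : ℤ) - zetaZeroCount T =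
      ∑ ρ ∈ (boxFinset T').filter (fun ρ ↦ ¬ρ.im ≤ T), riemannZetaZeroOrder ρ := by
  classical
  rw [zetaZeroCount_eq_sum_filter h, zetaZeroCount_eq_sum_filter le_rfl]
  have hall : (boxFinset T').filter (fun ρ ↦ ρ.im ≤ T') = boxFinset T' :=
    Finset.filter_true_of_mem fun ρ hρ ↦ (mem_boxFinset.1 hρ).2.2.2.2
  rw [hall, ← Finset.sum_filter_add_sum_filter_not (boxFinset T') (fun ρ ↦ ρ.im ≤ T)]
  ring

/-- `N_s(T') − N_s(T) = #{ρ : m(ρ) = 1, T < Im ρ ≤ T'}` for `T ≤ T'`. [cite: BaluyotEtAl2025, §1.3 (N_s(B_b))] -/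
theorem simpleZeroCount_sub_eq {T T' : ℝ} (h : T ≤ T') :
    (simpleZeroCount T' : ℤ) - simpleZeroCount T =
      ((boxFinset T').filter fun ρ ↦ riemannZetaZeroOrder ρ = 1 ∧ ¬ρ.im ≤ T).card := by
  classical
  rw [simpleZeroCount_eq_card_filter h, simpleZeroCount_eq_card_filter (le_refl T')]
  have hall : ((boxFinset T').filter fun ρ ↦ riemannZetaZeroOrder ρ = 1 ∧ ρ.im ≤ T') =
      (boxFinset T').filter fun ρ ↦ riemannZetaZeroOrder ρ = 1 :=
    Finset.filter_congr fun ρ hρ ↦ by simp [(mem_boxFinset.1 hρ).2.2.2.2]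
  rw [hall, ← Finset.card_filter_add_card_filter_not
    (s := (boxFinset T').filter fun ρ ↦ riemannZetaZeroOrder ρ = 1) (fun ρ ↦ ρ.im ≤ T),
    Finset.filter_filter, Finset.filter_filter]
  push_cast
  ring

/-- `N⁽¹⁾(T') − N⁽¹⁾(T) = #{ρ : Re ρ = ½, m(ρ) = 1, T < Im ρ ≤ T'}` for `T ≤ T'`. [cite: BaluyotEtAl2025, §1.3 (N₀ˢ(B_b))] -/
theorem simpleCriticalZeroCount_sub_eq {T T' : ℝ} (h : T ≤ T') :
    (simpleCriticalZeroCount T' : ℤ) - simpleCriticalZeroCount T =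
      ((boxFinset T').filter fun ρ ↦
        (ρ.re = 1 / 2 ∧ riemannZetaZeroOrder ρ = 1) ∧ ¬ρ.im ≤ T).card := by
  classical
  rw [simpleCriticalZeroCount_eq_card_filter h, simpleCriticalZeroCount_eq_card_filter (le_refl T')]
  have hall : ((boxFinset T').filter fun ρ ↦
      (ρ.re = 1 / 2 ∧ riemannZetaZeroOrder ρ = 1) ∧ ρ.im ≤ T') =
      (boxFinset T').filter fun ρ ↦ ρ.re = 1 / 2 ∧ riemannZetaZeroOrder ρ = 1 :=
    Finset.filter_congr fun ρ hρ ↦ by simp [(mem_boxFinset.1 hρ).2.2.2.2]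
  rw [hall, ← Finset.card_filter_add_card_filter_not
    (s := (boxFinset T').filter fun ρ ↦ ρ.re = 1 / 2 ∧ riemannZetaZeroOrder ρ = 1)
    (fun ρ ↦ ρ.im ≤ T), Finset.filter_filter, Finset.filter_filter]
  push_cast
  ring

/-- `N₀(T') − N₀(T) = Σ_{Re ρ = ½, T < Im ρ ≤ T'} m(ρ)` for `T ≤ T'`. [cite: Titchmarsh1986, §10.1] -/
theorem criticalZeroCount_sub_eq {T T' : ℝ} (h : T ≤ T') :
    (criticalZeroCount T' : ℤ) - criticalZeroCount T =
      ∑ ρ ∈ (boxFinset T').filter (fun ρ ↦ ρ.re = 1 / 2 ∧ ¬ρ.im ≤ T), riemannZetaZeroOrder ρ := by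
  classical
  rw [criticalZeroCount_eq_sum_filter h, criticalZeroCount_eq_sum_filter (le_refl T')]
  have hall : ((boxFinset T').filter fun ρ ↦ ρ.re = 1 / 2 ∧ ρ.im ≤ T') =
      (boxFinset T').filter fun ρ ↦ ρ.re = 1 / 2 :=
    Finset.filter_congr fun ρ hρ ↦ by simp [(mem_boxFinset.1 hρ).2.2.2.2]
  rw [hall, ← Finset.sum_filter_add_sum_filter_not
    ((boxFinset T').filter fun ρ ↦ ρ.re = 1 / 2) (fun ρ ↦ ρ.im ≤ T), Finset.filter_filter,
    Finset.filter_filter]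
  ring

/-- **Simple zeros on the line in a window are simple zeros in the window**:
`N⁽¹⁾(T') − N⁽¹⁾(T) ≤ N_s(T') − N_s(T)` (`T ≤ T'`). [cite: BaluyotEtAl2025, §1.3 (N_s(B_b), N₀ˢ(B_b))] -/
theorem simpleCriticalZeroCount_window_le_simpleZeroCount_window {T T' : ℝ} (h : T ≤ T') :
    (simpleCriticalZeroCount T' : ℝ) + simpleZeroCount T ≤
      (simpleZeroCount T' : ℝ) + simpleCriticalZeroCount T := by
  classical
  have hz : (simpleCriticalZeroCount T' : ℤ) - simpleCriticalZeroCount T ≤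
      (simpleZeroCount T' : ℤ) - simpleZeroCount T := by
    rw [simpleCriticalZeroCount_sub_eq h, simpleZeroCount_sub_eq h]
    exact_mod_cast Finset.card_le_card fun ρ hρ ↦ by
      rw [Finset.mem_filter] at hρ ⊢
      exact ⟨hρ.1, hρ.2.1.2, hρ.2.2⟩
  have hr : ((simpleCriticalZeroCount T' : ℤ) : ℝ) - ((simpleCriticalZeroCount T : ℤ) : ℝ) ≤
      ((simpleZeroCount T' : ℤ) : ℝ) - ((simpleZeroCount T : ℤ) : ℝ) := by exact_mod_cast hz
  push_cast at hr
  linarith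

/-- **Simple zeros on the line in a window are zeros on the line in the window** (each of multiplicity
one among multiplicities `≥ 1`): `N⁽¹⁾(T') − N⁽¹⁾(T) ≤ N₀(T') − N₀(T)` (`T ≤ T'`).
[cite: BaluyotEtAl2025, §1.3 (N₀(B_b), N₀ˢ(B_b))] -/
theorem simpleCriticalZeroCount_window_le_criticalZeroCount_window {T T' : ℝ} (h : T ≤ T') :
    (simpleCriticalZeroCount T' : ℝ) + criticalZeroCount T ≤
      (criticalZeroCount T' : ℝ) + simpleCriticalZeroCount T := by
  classical
  have hz : (simpleCriticalZeroCount T' : ℤ) - simpleCriticalZeroCount T ≤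
      (criticalZeroCount T' : ℤ) - criticalZeroCount T := by
    rw [simpleCriticalZeroCount_sub_eq h, criticalZeroCount_sub_eq h, Finset.card_eq_sum_ones]
    push_cast
    calc (∑ ρ ∈ (boxFinset T').filter
            (fun ρ ↦ (ρ.re = 1 / 2 ∧ riemannZetaZeroOrder ρ = 1) ∧ ¬ρ.im ≤ T), (1 : ℤ))
        ≤ ∑ ρ ∈ (boxFinset T').filter
            (fun ρ ↦ (ρ.re = 1 / 2 ∧ riemannZetaZeroOrder ρ = 1) ∧ ¬ρ.im ≤ T),
              riemannZetaZeroOrder ρ :=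
          Finset.sum_le_sum fun ρ hρ ↦ one_le_order_of_mem (Finset.mem_filter.1 hρ).1
      _ ≤ ∑ ρ ∈ (boxFinset T').filter (fun ρ ↦ ρ.re = 1 / 2 ∧ ¬ρ.im ≤ T),
            riemannZetaZeroOrder ρ := by
          refine Finset.sum_le_sum_of_subset_of_nonneg (fun ρ hρ ↦ ?_) fun ρ hρ _ ↦ ?_
          · rw [Finset.mem_filter] at hρ ⊢
            exact ⟨hρ.1, hρ.2.1.1, hρ.2.2⟩
          · have := one_le_order_of_mem (Finset.mem_filter.1 hρ).1
            omega
  have hr : ((simpleCriticalZeroCount T' : ℤ) : ℝ) - ((simpleCriticalZeroCount T : ℤ) : ℝ) ≤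
      ((criticalZeroCount T' : ℤ) : ℝ) - ((criticalZeroCount T : ℤ) : ℝ) := by exact_mod_cast hz
  push_cast at hr
  linarith

/-- **The dyadic count against `(T/2π) log T`**: for every `δ > 0`, eventually
`(1 − δ)(T/2π) log T ≤ N(2T) − N(T) ≤ (1 + δ)(T/2π) log T` — from the tree's explicit
`|N(2T) − N(T) − (T/2π) log(T/2π)| ≤ T` (`AlpogeFurman2026.abs_dyadic_count_sub_le`, `T ≥ 260`).
[cite: Titchmarsh1986, Thm. 9.4] -/
theorem eventually_dyadic_count_near_main (δ : ℝ) (hδ : 0 < δ) :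
    ∀ᶠ T : ℝ in atTop,
      (1 - δ) * (T / (2 * π) * Real.log T) ≤ (zetaZeroCount (2 * T) : ℝ) - zetaZeroCount T ∧
        (zetaZeroCount (2 * T) : ℝ) - zetaZeroCount T ≤ (1 + δ) * (T / (2 * π) * Real.log T) := by
  have hπ : 0 < π := Real.pi_pos
  have hlog : ∀ᶠ T : ℝ in atTop, (2 * π + Real.log (2 * π)) / δ ≤ Real.log T :=
    Real.tendsto_log_atTop.eventually_ge_atTop _
  filter_upwards [hlog, eventually_ge_atTop (260 : ℝ)] with T hK hT
  have hT0 : 0 < T := by linarith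
  have h := AlpogeFurman2026.abs_dyadic_count_sub_le hT
  rw [abs_le] at h
  obtain ⟨h1, h2⟩ := h
  have hLH : AlpogeFurman2026.logHeight T = Real.log T - Real.log (2 * π) := by
    rw [AlpogeFurman2026.logHeight, Real.log_div hT0.ne' (by positivity)]
  rw [hLH] at h1 h2
  have hl2π : 0 < Real.log (2 * π) := Real.log_pos (by linarith [Real.pi_gt_three])
  -- `T·(2π + log 2π) ≤ δ · T · log T`
  have hK' : 2 * π + Real.log (2 * π) ≤ δ * Real.log T := by
    rwa [div_le_iff₀' hδ] at hK
  have hkey : T + T * Real.log (2 * π) / (2 * π) ≤ δ * (T / (2 * π) * Real.log T) := by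
    rw [show T + T * Real.log (2 * π) / (2 * π) = T / (2 * π) * (2 * π + Real.log (2 * π)) by
      field_simp]
    rw [show δ * (T / (2 * π) * Real.log T) = T / (2 * π) * (δ * Real.log T) by ring]
    exact mul_le_mul_of_nonneg_left hK' (by positivity)
  constructor
  · have : T * (Real.log T - Real.log (2 * π)) / (2 * π) - T ≤
        (zetaZeroCount (2 * T) : ℝ) - zetaZeroCount T := by linarith
    have e : T * (Real.log T - Real.log (2 * π)) / (2 * π) =
        T / (2 * π) * Real.log T - T * Real.log (2 * π) / (2 * π) := by ring
    rw [e] at this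
    linarith
  · have : (zetaZeroCount (2 * T) : ℝ) - zetaZeroCount T ≤
        T * (Real.log T - Real.log (2 * π)) / (2 * π) + T := by linarith
    have e : T * (Real.log T - Real.log (2 * π)) / (2 * π) =
        T / (2 * π) * Real.log T - T * Real.log (2 * π) / (2 * π) := by ring
    rw [e] at this
    have : 0 ≤ T * Real.log (2 * π) / (2 * π) := by positivity
    linarith

end BGSTB2025

/-! ## §2 The Montgomery–Taylor constant to eight decimals

Same method as `MontgomeryTaylorConstantNumerics.lean` (whose helper lemmas are private; the short
computation is repeated here so that the [AF26] cone, which imports that file, is not rebuilt): with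
`x₀ = 1/√2`, `z = i x₀`, `z² = −½`, the degree-9 Taylor polynomial of `exp` at `z` is `A + B z`,
`A = 163483/215040`, `B = 5334193/5806080`, and `Complex.exp_bound` gives `|cos x₀ − A|`,
`|sin x₀ − B x₀| ≤ 10⁻⁸`; then `c_MT⁻¹ = ½ + x₀ cos x₀ / sin x₀` is pinned by linear arithmetic. The
six-decimal `montgomeryTaylorInvConstant_bounds` used `x₀ > 0.7071` against margins of `10⁻⁶`; here the
margins are `≈ 10⁻⁸` and the same `x₀`-bound suffices. -/

namespace MTSharp

/-- `x₀ = 1/√2`: positivity, square, and `x₀ > 0.7071`. [folklore] -/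
private theorem x0_facts :
    0 < 1 / Real.sqrt 2 ∧ (1 / Real.sqrt 2) ^ 2 = 1 / 2 ∧ (0.7071 : ℝ) < 1 / Real.sqrt 2 := by
  have hpos : 0 < 1 / Real.sqrt 2 := by positivity
  have hsq : (1 / Real.sqrt 2) ^ 2 = 1 / 2 := by
    rw [div_pow, one_pow, Real.sq_sqrt (by norm_num : (0:ℝ) ≤ 2)]
  refine ⟨hpos, hsq, ?_⟩
  nlinarith [hsq, hpos]

/-- Degree-9 Taylor data at `z` with `z² = −½`: `Σ_{m<10} z^m/m! = A + B z`. [folklore] -/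
private theorem taylor_sum (z : ℂ) (hz2 : z ^ 2 = -(1 / 2 : ℂ)) :
    ∑ m ∈ range 10, z ^ m / (m.factorial : ℂ) =
      (163483 / 215040 : ℂ) + (5334193 / 5806080 : ℂ) * z := by
  simp only [sum_range_succ, sum_range_zero, Nat.factorial, Nat.succ_eq_add_one, Nat.cast_mul,
    Nat.cast_add, Nat.cast_one, Nat.cast_ofNat]
  linear_combination ((51557/107520 : ℂ) + (471887/2903040 : ℂ) * z + (2203/53760 : ℂ) * z ^ 2 +
    (11953/1451520 : ℂ) * z ^ 3 + (37/26880 : ℂ) * z ^ 4 + (143/725760 : ℂ) * z ^ 5 +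
    (1/40320 : ℂ) * z ^ 6 + (1/362880 : ℂ) * z ^ 7) * hz2

/-- `|cos x₀ − A| ≤ ε`, `|sin x₀ − B x₀| ≤ ε`, `ε = (1/32)·11/(10!·10)`. [folklore] -/
private theorem cos_sin_bounds :
    |Real.cos (1 / Real.sqrt 2) - 163483 / 215040| ≤ (1 / 32) * (11 * (3628800 * 10 : ℝ)⁻¹) ∧
      |Real.sin (1 / Real.sqrt 2) - 5334193 / 5806080 * (1 / Real.sqrt 2)| ≤
        (1 / 32) * (11 * (3628800 * 10 : ℝ)⁻¹) := by
  obtain ⟨hpos, hsq, -⟩ := x0_facts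
  set x₀ : ℝ := 1 / Real.sqrt 2 with hx₀
  set z : ℂ := (x₀ : ℂ) * Complex.I with hz
  have hnorm : ‖z‖ = x₀ := by
    rw [hz, norm_mul, Complex.norm_I, mul_one, Complex.norm_real, Real.norm_eq_abs, abs_of_pos hpos]
  have hz2 : z ^ 2 = -(1 / 2 : ℂ) := by
    rw [hz, mul_pow, Complex.I_sq, ← Complex.ofReal_pow, hsq]
    push_cast
    ring
  have hE := Complex.exp_bound (x := z) (by rw [hnorm]; nlinarith) (n := 10) (by norm_num)
  rw [taylor_sum z hz2, hnorm, show x₀ ^ 10 = (x₀ ^ 2) ^ 5 by ring, hsq] at hE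
  norm_num [Nat.factorial] at hE
  have hre := (Complex.abs_re_le_norm _).trans hE
  have him := (Complex.abs_im_le_norm _).trans hE
  rw [Complex.sub_re, hz, Complex.exp_ofReal_mul_I_re] at hre
  rw [Complex.sub_im, hz, Complex.exp_ofReal_mul_I_im] at him
  simp only [Complex.add_re, Complex.add_im, Complex.mul_re, Complex.mul_im, Complex.I_re,
    Complex.I_im, Complex.ofReal_re, Complex.ofReal_im, Complex.div_ofNat_re, Complex.div_ofNat_im,
    mul_zero, mul_one, sub_zero, add_zero] at hre him
  norm_num at hre him ⊢
  exact ⟨hre, him⟩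

end MTSharp

open MTSharp in
/-- **The Montgomery–Taylor constant to eight decimals**: `1.3274992 < c_MT⁻¹ < 1.32749935`
(`c_MT⁻¹ = ½ + (1/√2) cot(1/√2) = 1.32749929…`; sharpens `montgomeryTaylorInvConstant_bounds`). Hence
`2 − c_MT⁻¹ > 0.67250065`, above [BGSTB25]'s printed `0.67250064`.
[cite: AlpogeFurman2026, Lemma 5.6 (p. 11)] [cite: BaluyotEtAl2025, Theorem 2 (the constant 0.67250064)] -/
theorem montgomeryTaylorInvConstant_bounds_sharp :
    (1.3274992 : ℝ) < montgomeryTaylorInvConstant ∧ montgomeryTaylorInvConstant < 1.32749935 := by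
  obtain ⟨hpos, -, hlo⟩ := x0_facts
  obtain ⟨hcos, hsin⟩ := cos_sin_bounds
  rw [abs_le] at hcos hsin
  obtain ⟨hcos₁, hcos₂⟩ := hcos
  obtain ⟨hsin₁, hsin₂⟩ := hsin
  set x₀ : ℝ := 1 / Real.sqrt 2 with hx₀
  have hsin_pos : 0 < Real.sin x₀ := by nlinarith
  unfold montgomeryTaylorInvConstant
  rw [← hx₀, Real.cot_eq_cos_div_sin, ← mul_div_assoc]
  constructor
  · -- lower bound: `0.8274992 · sin x₀ < x₀ cos x₀`
    have h1 : x₀ * (163483 / 215040 - 1 / 32 * (11 * (3628800 * 10 : ℝ)⁻¹)) ≤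
        x₀ * Real.cos x₀ := mul_le_mul_of_nonneg_left (by linarith) hpos.le
    have h2 : (0.7071 : ℝ) * (163483 / 215040 - 1 / 32 * (11 * (3628800 * 10 : ℝ)⁻¹) -
        0.8274992 * (5334193 / 5806080)) < x₀ * (163483 / 215040 -
        1 / 32 * (11 * (3628800 * 10 : ℝ)⁻¹) - 0.8274992 * (5334193 / 5806080)) :=
      mul_lt_mul_of_pos_right hlo (by norm_num)
    rw [← sub_pos, show (1 : ℝ) / 2 + x₀ * Real.cos x₀ / Real.sin x₀ - 1.3274992 =
      (x₀ * Real.cos x₀ - 0.8274992 * Real.sin x₀) / Real.sin x₀ by field_simp; ring]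
    refine div_pos ?_ hsin_pos
    nlinarith
  · -- upper bound: `x₀ cos x₀ < 0.82749935 · sin x₀`
    have h1 : x₀ * Real.cos x₀ ≤
        x₀ * (163483 / 215040 + 1 / 32 * (11 * (3628800 * 10 : ℝ)⁻¹)) :=
      mul_le_mul_of_nonneg_left (by linarith) hpos.le
    have h2 : (0.7071 : ℝ) * (0.82749935 * (5334193 / 5806080) - 163483 / 215040 -
        1 / 32 * (11 * (3628800 * 10 : ℝ)⁻¹)) < x₀ * (0.82749935 * (5334193 / 5806080) -
        163483 / 215040 - 1 / 32 * (11 * (3628800 * 10 : ℝ)⁻¹)) :=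
      mul_lt_mul_of_pos_right hlo (by norm_num)
    rw [← sub_pos, show (1.32749935 : ℝ) - (1 / 2 + x₀ * Real.cos x₀ / Real.sin x₀) =
      (0.82749935 * Real.sin x₀ - x₀ * Real.cos x₀) / Real.sin x₀ by field_simp; ring]
    refine div_pos ?_ hsin_pos
    nlinarith

/-- `2 − c_MT⁻¹ ∈ (0.67250065, 0.6725008)`. [cite: AlpogeFurman2026, Theorem A (p. 1), the decimal 0.67250] -/
theorem two_sub_montgomeryTaylorInvConstant_bounds_sharp :
    (0.67250065 : ℝ) < 2 - montgomeryTaylorInvConstant ∧ 2 - montgomeryTaylorInvConstant < 0.6725008 := by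
  have h := montgomeryTaylorInvConstant_bounds_sharp
  constructor <;> linarith [h.1, h.2]

/-! ## §3 The same-ordinate pair count: the printed normalisation, `C ≥ 1`, [GS26] Lemma 1, [GS25] Theorem 2 -/

namespace GLSS2026

/-- **The hypothesis of [GS25] Theorem 2 / [GS26] Theorem 2, AS PRINTED**: "there exists a constant `C`
such that, as `T → ∞`,
`Σ_{ρ,ρ': 0<γ,γ'≤T, γ=γ'} 1 ≤ (C + o(1)) (T/2π) log T`" — for every `ε > 0`, eventually
`N⊛(T) ≤ (C + ε)(T/2π) log T`. A PREDICATE (hypothesis shape), equivalent to the tree's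
`GLSS2026.CoincidentPairBound C` (normalised by `N(T) ∼ (T/2π) log T`), see
`coincidentPairBoundPrinted_iff`. [cite: GoldstonSuriajaya2026, §4 Theorem 2 (hypothesis)] [cite: GoldstonSuriajaya2025, §4 Theorem 2 (hypothesis)] -/
def CoincidentPairBoundPrinted (C : ℝ) : Prop :=
  ∀ ε : ℝ, 0 < ε → ∀ᶠ T : ℝ in atTop,
    (coincidentPairCount T : ℝ) ≤ (C + ε) * (T / (2 * π) * Real.log T)

/-- Arithmetic of the `o(1)`-absorption: if `(1 − δ)M ≤ N`, `0 ≤ M`, `0 ≤ C + δ`, `δ ≤ ½` and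
`3δ(C + 1) ≤ ε`, then `X ≤ (C + δ)M` implies `X ≤ (C + ε)N`. [folklore] -/
private theorem absorb {C δ ε M N X : ℝ} (hCδ : 0 ≤ C + δ) (hδ : 0 ≤ δ) (hδ1 : δ ≤ 1 / 2)
    (hδε : 3 * δ * (C + 2) ≤ ε) (hM : 0 ≤ M) (hMN : (1 - δ) * M ≤ N) (hX : X ≤ (C + δ) * M) :
    X ≤ (C + ε) * N := by
  have hN : 0 ≤ N := le_trans (by nlinarith) hMN
  have hM2 : M ≤ 2 * N := by nlinarith
  have h1 : (C + δ) * M * (1 - δ) ≤ (C + δ) * N := by nlinarith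
  have h2 : (C + δ) * M = (C + δ) * M * (1 - δ) + δ * ((C + δ) * M) := by ring
  have h3 : δ * ((C + δ) * M) ≤ δ * ((C + 1) * (2 * N)) := by
    apply mul_le_mul_of_nonneg_left _ hδ
    nlinarith
  have h4 : δ * (2 * C + 3) ≤ ε := by nlinarith
  have h5 : δ * (2 * C + 3) * N ≤ ε * N := mul_le_mul_of_nonneg_right h4 hN
  have h6 : X ≤ (C + δ) * N + δ * ((C + 1) * (2 * N)) := by linarith
  have h7 : (C + δ) * N + δ * ((C + 1) * (2 * N)) = C * N + δ * (2 * C + 3) * N := by ring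
  have h8 : (C + ε) * N = C * N + ε * N := by ring
  linarith

/-- The same absorption in the other direction: from `N ≤ (1 + δ)M`, `X ≤ (C + δ)N` gives
`X ≤ (C + ε)M` when `0 ≤ C + δ`, `δ ≤ 1`, `3δ(C + 1) ≤ ε`. [folklore] -/
private theorem absorb' {C δ ε M N X : ℝ} (hC : 1 ≤ C) (hδ : 0 ≤ δ) (hδ1 : δ ≤ 1)
    (hδε : 3 * δ * (C + 1) ≤ ε) (hM : 0 ≤ M) (hNM : N ≤ (1 + δ) * M) (hX : X ≤ (C + δ) * N) :
    X ≤ (C + ε) * M := by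
  have hCδ : 0 ≤ C + δ := by linarith
  have h1 : (C + δ) * N ≤ (C + δ) * ((1 + δ) * M) := mul_le_mul_of_nonneg_left hNM hCδ
  have h2 : (C + δ) * ((1 + δ) * M) = C * M + δ * (C + 1 + δ) * M := by ring
  have h3 : δ * (C + 1 + δ) * M ≤ δ * (3 * (C + 1)) * M := by
    apply mul_le_mul_of_nonneg_right _ hM
    apply mul_le_mul_of_nonneg_left _ hδ
    linarith
  have h4 : δ * (3 * (C + 1)) * M ≤ ε * M := mul_le_mul_of_nonneg_right (by linarith) hM
  have h5 : (C + ε) * M = C * M + ε * M := by ring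
  linarith

/-- `N(T) ≤ N⊛(T)` forces `C ≥ 1` in the hypothesis ([GS25] (4.2): "Thus `C` in our assumption has to
satisfy `C ≥ 1`"). [cite: GoldstonSuriajaya2025, §4, proof of Theorem 2 (first remark)] -/
theorem one_le_of_coincidentPairBound {C : ℝ} (h : CoincidentPairBound C) : 1 ≤ C := by
  by_contra hC
  push Not at hC
  have hε : 0 < (1 - C) / 2 := by linarith
  have hN : Tendsto zetaZeroCount atTop atTop := tendsto_zetaZeroCount_atTop_holds
  obtain ⟨T, hT, hT1⟩ := ((h _ hε).and (hN.eventually_gt_atTop 0)).exists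
  have hle : (zetaZeroCount T : ℝ) ≤ coincidentPairCount T := by
    exact_mod_cast zetaZeroCount_le_coincidentPairCount T
  have hpos : (0 : ℝ) < zetaZeroCount T := by exact_mod_cast hT1
  nlinarith

/-- **Printed ⟹ tree normalisation**: `N⊛ ≤ (C + o(1))(T/2π) log T` gives `N⊛ ≤ (C + o(1))N(T)`,
by `N(T) ≥ (1 − δ)(T/2π) log T` eventually (Riemann–von Mangoldt, [GS26] §3). [cite: GoldstonSuriajaya2026, §3 (N(T) ∼ (T/2π) log T)] -/
theorem coincidentPairBound_of_printed {C : ℝ} (h : CoincidentPairBoundPrinted C) :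
    CoincidentPairBound C := by
  -- first `C ≥ 1 − something`: we only need `0 ≤ C + δ`, obtained from `N ≤ N⊛ ≤ (C+δ)M`, `M > 0`
  intro ε hε
  set δ : ℝ := min (1 / 2) (ε / (3 * (|C| + 2))) with hδdef
  have hδpos : 0 < δ := lt_min (by norm_num) (by positivity)
  have hδ1 : δ ≤ 1 / 2 := min_le_left _ _
  have hδε : 3 * δ * (|C| + 2) ≤ ε := by
    have h1 : δ ≤ ε / (3 * (|C| + 2)) := min_le_right _ _
    have := mul_le_mul_of_nonneg_left h1 (show (0:ℝ) ≤ 3 * (|C| + 2) by positivity)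
    rw [mul_div_cancel₀ _ (by positivity)] at this
    linarith
  have hδε' : 3 * δ * (C + 2) ≤ ε :=
    le_trans (by nlinarith [le_abs_self C, hδpos.le]) hδε
  filter_upwards [h δ hδpos, AlpogeFurman2026.eventually_zetaZeroCount_near_main δ hδpos,
    eventually_gt_atTop (1 : ℝ)] with T hX hN hT
  have hM : 0 < T / (2 * π) * Real.log T := by
    have := Real.log_pos hT; positivity
  have hNle : (zetaZeroCount T : ℝ) ≤ coincidentPairCount T := by
    exact_mod_cast zetaZeroCount_le_coincidentPairCount T
  have hCδ : 0 ≤ C + δ := by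
    -- `0 ≤ (1 − δ)M ≤ N ≤ N⊛ ≤ (C + δ)M` with `M > 0`
    have : (0 : ℝ) ≤ (C + δ) * (T / (2 * π) * Real.log T) := by
      have h0 : (0 : ℝ) ≤ zetaZeroCount T := Nat.cast_nonneg _
      linarith
    exact nonneg_of_mul_nonneg_left this hM
  exact absorb hCδ hδpos.le hδ1 hδε' hM.le hN.1 hX

/-- **Tree ⟹ printed normalisation**, by `N(T) ≤ (1 + δ)(T/2π) log T` eventually.
[cite: GoldstonSuriajaya2026, §3 (N(T) ∼ (T/2π) log T)] -/
theorem printed_of_coincidentPairBound {C : ℝ} (h : CoincidentPairBound C) :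
    CoincidentPairBoundPrinted C := by
  have hC := one_le_of_coincidentPairBound h
  intro ε hε
  set δ : ℝ := min 1 (ε / (3 * (C + 1))) with hδdef
  have hδpos : 0 < δ := lt_min one_pos (by positivity)
  have hδ1 : δ ≤ 1 := min_le_left _ _
  have hδε : 3 * δ * (C + 1) ≤ ε := by
    have h1 : δ ≤ ε / (3 * (C + 1)) := min_le_right _ _
    have := mul_le_mul_of_nonneg_left h1 (show (0:ℝ) ≤ 3 * (C + 1) by positivity)
    rw [mul_div_cancel₀ _ (by positivity)] at this
    linarith
  filter_upwards [h δ hδpos, AlpogeFurman2026.eventually_zetaZeroCount_near_main δ hδpos,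
    eventually_gt_atTop (1 : ℝ)] with T hX hN hT
  have hM : 0 < T / (2 * π) * Real.log T := by
    have := Real.log_pos hT; positivity
  exact absorb' hC hδpos.le hδ1 hδε hM.le hN.2 hX

/-- The two normalisations of the hypothesis agree. [cite: GoldstonSuriajaya2026, §4 Theorem 2 (hypothesis)] -/
theorem coincidentPairBoundPrinted_iff {C : ℝ} : CoincidentPairBoundPrinted C ↔ CoincidentPairBound C :=
  ⟨coincidentPairBound_of_printed, printed_of_coincidentPairBound⟩

/-- The coincident pairs are among the pairs within one mean spacing (`|x_p| ≤ 1`; indeed `x_p = 0`).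
[cite: GoldstonLeeSchettlerSuriajaya2026, §3 eq. (3.1)] -/
theorem coincidentPairCount_le_card_closePairs (T : ℝ) :
    coincidentPairCount T ≤ (closePairs T 1).card := by
  classical
  unfold coincidentPairCount
  refine Finset.card_le_card fun p hp ↦ ?_
  rw [Finset.mem_filter] at hp
  rw [mem_closePairs]
  refine ⟨hp.1, ?_⟩
  rw [AH.pairSpacing, hp.2, sub_self, zero_mul, zero_div, abs_zero]
  exact zero_le_one

end GLSS2026

/-- **[GS26] Lemma 1, second display — PROVED unconditionally**: "if `h = 0`, then there exists a
constant `C ≥ 1` for which `Σ_{ρ,ρ': 0<γ,γ'≤T, γ=γ'} 1 ≤ (C + o(1))(T/2π) log T`" (the sources cite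
Goldston–Montgomery 1987 and Gallagher–Mueller 1978 after Fujii 1974 / Selberg 1946). Here: the
coincident pairs are pairs within one mean spacing, whose number is `O(T log T)` by the tree's
`GLSS2026.exists_eventually_card_closePairs_le`, fed by the DISCHARGED second-moment statement
`glss2026_dsec2_holds` (Fujii's mean square); `C ≥ 1` by `GLSS2026.one_le_of_coincidentPairBound`.
The first display (general `0 ≤ h ≤ T`, `≪ (1 + h log T) T log T`) is not typed.
[cite: GoldstonSuriajaya2026, §5 Lemma 1 (second display)] -/
theorem goldstonSuriajaya2026_lemma1 : ∃ C : ℝ, 1 ≤ C ∧ GLSS2026.CoincidentPairBoundPrinted C := by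
  obtain ⟨C, -, hC⟩ := GLSS2026.exists_eventually_card_closePairs_le glss2026_dsec2_holds one_pos
  have hP : GLSS2026.CoincidentPairBoundPrinted C := by
    intro ε hε
    filter_upwards [hC, eventually_gt_atTop (1 : ℝ)] with T hT hT1
    have h1 : (GLSS2026.coincidentPairCount T : ℝ) ≤ (GLSS2026.closePairs T 1).card := by
      exact_mod_cast GLSS2026.coincidentPairCount_le_card_closePairs T
    have hL : T * GLSS2026.L T = T / (2 * π) * Real.log T := by rw [GLSS2026.L]; ring
    rw [hL] at hT
    have hM : 0 ≤ T / (2 * π) * Real.log T := by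
      have := Real.log_pos hT1; positivity
    nlinarith
  exact ⟨C, GLSS2026.one_le_of_coincidentPairBound (GLSS2026.coincidentPairBound_of_printed hP), hP⟩

/-- **[GS25] Theorem 2 — PROVED.** "Suppose there exists a constant `C` where `1 ≤ C < 2` and that, as
`T → ∞`, `Σ_{ρ,ρ': 0<γ,γ'≤T, γ=γ'} 1 ≤ (C + o(1))(T/2π) log T`. Then asymptotically at least the
proportion `2 − C` of the zeros of `ζ(s)` are simple; at least the proportion `2 − C` of the zeros of
`ζ(s)` are on the critical line; and if `1 ≤ C < 3/2` then at least the proportion `3 − 2C` of the zeros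
of `ζ(s)` are simple zeros on the critical line." Rendered junk-free ("proportion ≥ p" = for every
`ε > 0`, eventually `(p − ε)N(T) ≤ count`; simple = `simpleZeroCount`, on the line = `criticalZeroCount`
with multiplicity, simple on the line = `simpleCriticalZeroCount`). All three follow from the sharper
[GS26] Theorem 2 (i) (`GLSS2026.simpleCritical_lower`: `≥ 2 − C` simple AND on the line), as
`3 − 2C ≤ 2 − C` for `C ≥ 1`; the printed restriction `C < 2` only makes the conclusions non-vacuous and
is omitted (the theorem as stated here is stronger). [cite: GoldstonSuriajaya2025, Theorem 2] -/
theorem goldstonSuriajaya2025_theorem2 {C : ℝ} (hC : 1 ≤ C) (h : GLSS2026.CoincidentPairBoundPrinted C) :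
    (∀ ε : ℝ, 0 < ε → ∀ᶠ T : ℝ in atTop, (2 - C - ε) * (zetaZeroCount T : ℝ) ≤ simpleZeroCount T) ∧
    (∀ ε : ℝ, 0 < ε → ∀ᶠ T : ℝ in atTop, (2 - C - ε) * (zetaZeroCount T : ℝ) ≤ criticalZeroCount T) ∧
    (C < 3 / 2 → ∀ ε : ℝ, 0 < ε → ∀ᶠ T : ℝ in atTop,
      (3 - 2 * C - ε) * (zetaZeroCount T : ℝ) ≤ simpleCriticalZeroCount T) := by
  have h' := GLSS2026.coincidentPairBound_of_printed h
  refine ⟨fun ε hε ↦ ?_, fun ε hε ↦ ?_, fun _ ε hε ↦ ?_⟩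
  · filter_upwards [GLSS2026.simpleCritical_lower h' ε hε] with T hT
    exact hT.trans (by exact_mod_cast GLSS2026.simpleCriticalZeroCount_le_simpleZeroCount T)
  · filter_upwards [GLSS2026.simpleCritical_lower h' ε hε] with T hT
    exact hT.trans (by exact_mod_cast simpleCriticalZeroCount_le_criticalZeroCount T)
  · filter_upwards [GLSS2026.simpleCritical_lower h' ε hε] with T hT
    have hN : (0 : ℝ) ≤ zetaZeroCount T := Nat.cast_nonneg _
    nlinarith

/-- **[GS26] Theorem 2 (i) in the printed normalisation** (for reference; the counting is the tree's
`GLSS2026.simpleCritical_lower`): under (4.1), for every `ε > 0`, eventually `(2 − C − ε)N(T) ≤ N⁽¹⁾(T)`.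
[cite: GoldstonSuriajaya2026, Theorem 2 (i)] -/
theorem goldstonSuriajaya2026_theorem2_i {C : ℝ} (h : GLSS2026.CoincidentPairBoundPrinted C) :
    ∀ ε : ℝ, 0 < ε → ∀ᶠ T : ℝ in atTop, (2 - C - ε) * (zetaZeroCount T : ℝ) ≤ simpleCriticalZeroCount T :=
  fun ε hε ↦ GLSS2026.simpleCritical_lower (GLSS2026.coincidentPairBound_of_printed h) ε hε

/-! ## §4 Narrow vertical boxes: [BGSTB25] Theorems 1–2 and [GS26] Theorem 1 — typed and DISCHARGED -/

namespace BGSTB2025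

/-- **The box hypothesis at height `T` with width parameter `b`** ([BGSTB25] (1.1), [GS25] (5.1),
[GS26] (1.1)): every zero `ρ = β + iγ` of `ζ` with `T < γ ≤ 2T` lies in
`B_b = {|σ − ½| < b/(2 log T), T < t ≤ 2T}`. A PREDICATE, never asserted.
[cite: BaluyotEtAl2025, §1.3 (definition of B_b)] -/
def InNarrowBox (b T : ℝ) : Prop :=
  ∀ ρ : ℂ, riemannZeta ρ = 0 → T < ρ.im → ρ.im ≤ 2 * T → |ρ.re - 1 / 2| < b / (2 * Real.log T)

/-- The box hypothesis is monotone in `b` (for `log T > 0`). [cite: BaluyotEtAl2025, §1.3 (definition of B_b)] -/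
theorem InNarrowBox.mono {b b' T : ℝ} (hT : 1 < T) (hbb' : b ≤ b') (h : InNarrowBox b T) :
    InNarrowBox b' T := fun ρ h0 h1 h2 ↦
  (h ρ h0 h1 h2).trans_le (div_le_div_of_nonneg_right hbb' (by have := Real.log_pos hT; positivity))

/-- Under RH every box hypothesis with `b > 0` holds at every `T > 1` (all zeros with `Im ρ > 0` have
`Re ρ = ½`); [GS26] §1: "if RH had been replaced by the assumption (B_b) …". [cite: GoldstonSuriajaya2026, §1 (last paragraph) and §6 ("if we assume RH so that β = β' = 1/2")] -/
theorem InNarrowBox.of_RH (hRH : RiemannHypothesis) {b T : ℝ} (hb : 0 < b) (hT : 1 < T) :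
    InNarrowBox b T := by
  intro ρ h0 h1 _
  have him : 0 < ρ.im := by linarith
  have hre : ρ.re = 1 / 2 :=
    re_eq_one_half_of_mem_zetaZeroBox hRH
      (DiophantineGeometry.mem_zetaZeroBox_of_riemannZeta_eq_zero h0 him le_rfl)
  rw [hre, sub_self, abs_zero]
  have := Real.log_pos hT
  positivity

end BGSTB2025

open BGSTB2025

/-- **[BGSTB25] Theorem 1** (arXiv:2501.14545, §1.3). "Assume that, for all
sufficiently large `T`, all the zeros `ρ = β + iγ` of `ζ(s)` with `T < γ ≤ 2T` are in `B_b`. Then we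
have, where `b → 0` as `T → ∞`, `N_s(B_b) ≥ (2/3 + o(1)) N(B_b)`, `N₀(B_b) ≥ (2/3 + o(1)) N(B_b)`, and
`N₀ˢ(B_b) ≥ (1/3 + o(1)) N(B_b)`" (zeros counted with multiplicity; Remark 2: (1.4) is known
unconditionally, Heath-Brown 1979 / Selberg, for the third display). Rendered with `b = b(T) → 0`, the hypothesis
`∀ᶠ T, InNarrowBox (b T) T`, and the box counts as the dyadic differences (dictionary in the module
docstring). NAMED FACT of an unrefereed preprint — but see `baluyotEtAl2025_theorem1_holds`: in this
tree the three conclusions hold with the hypothesis unused. [claim: BaluyotEtAl2025, status: under-review] -/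
def baluyotEtAl2025_theorem1 : Prop :=
  ∀ b : ℝ → ℝ, Tendsto b atTop (𝓝 0) → (∀ᶠ T : ℝ in atTop, InNarrowBox (b T) T) →
    (∀ ε : ℝ, 0 < ε → ∀ᶠ T : ℝ in atTop,
      (2 / 3 - ε) * ((zetaZeroCount (2 * T) : ℝ) - zetaZeroCount T) ≤
        (simpleZeroCount (2 * T) : ℝ) - simpleZeroCount T) ∧
    (∀ ε : ℝ, 0 < ε → ∀ᶠ T : ℝ in atTop,
      (2 / 3 - ε) * ((zetaZeroCount (2 * T) : ℝ) - zetaZeroCount T) ≤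
        (criticalZeroCount (2 * T) : ℝ) - criticalZeroCount T) ∧
    (∀ ε : ℝ, 0 < ε → ∀ᶠ T : ℝ in atTop,
      (1 / 3 - ε) * ((zetaZeroCount (2 * T) : ℝ) - zetaZeroCount T) ≤
        (simpleCriticalZeroCount (2 * T) : ℝ) - simpleCriticalZeroCount T)

/-- **[GS26] Theorem 1** (arXiv:2603.28104, §1; = [BGSTB25] Theorem 1 sharpened from `1/3` to `2/3`
for zeros that are BOTH simple and on the line, proved there in §8 from Theorem 2 (i) with `C = 4/3`).
"Assuming all of the zeros `ρ = β + iγ` of `ζ(s)` with `T < γ ≤ 2T` lie in the region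
`B_b = {s = σ + it : |σ − ½| < b/(2 log T), T < t ≤ 2T, b = b(T) → 0 as T → ∞}`. Then for the zeros
of `ζ(s)` with `T < γ ≤ 2T`, we have asymptotically that at least `2/3` are simple and on the critical
line." Rendered as for `baluyotEtAl2025_theorem1`. NAMED FACT of an unrefereed preprint; DISCHARGED
below (`goldstonSuriajaya2026_theorem1_holds`). [claim: GoldstonSuriajaya2026, status: under-review] -/
def goldstonSuriajaya2026_theorem1 : Prop :=
  ∀ b : ℝ → ℝ, Tendsto b atTop (𝓝 0) → (∀ᶠ T : ℝ in atTop, InNarrowBox (b T) T) →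
    ∀ ε : ℝ, 0 < ε → ∀ᶠ T : ℝ in atTop,
      (2 / 3 - ε) * ((zetaZeroCount (2 * T) : ℝ) - zetaZeroCount T) ≤
        (simpleCriticalZeroCount (2 * T) : ℝ) - simpleCriticalZeroCount T

/-- **[BGSTB25] Theorem 2** (arXiv:2501.14545, §1.3). "Assume that, for all
sufficiently large `T`, all the zeros `ρ = β + iγ` of `ζ(s)` with `T < γ ≤ 2T` are in `B_b`. Then as
`T → ∞`, we have `N_s(B_{0.3185}) ≥ (0.66666908 + o(1)) (T/2π) log T`,
`N₀(B_{0.3185}) ≥ (0.66666908 + o(1)) (T/2π) log T`, `N₀ˢ(B_{0.3185}) ≥ (0.33333816 + o(1)) (T/2π) log T`,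
and `N_s(B_{0.001}) ≥ (0.67250064 + o(1)) (T/2π) log T`, `N₀(B_{0.001}) ≥ (0.67250064 + o(1)) (T/2π) log T`,
`N₀ˢ(B_{0.001}) ≥ (0.34500129 + o(1)) (T/2π) log T`." Rendered: each of the two box hypotheses
(`b = 0.3185`, resp. `b = 0.001`, at all large `T`) implies its three eventual inequalities against
`(T/2π) log T`. NAMED FACT of an unrefereed preprint; DISCHARGED below (`baluyotEtAl2025_theorem2_holds`).
[claim: BaluyotEtAl2025, status: under-review] -/
def baluyotEtAl2025_theorem2 : Prop :=
  ((∀ᶠ T : ℝ in atTop, InNarrowBox 0.3185 T) →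
    (∀ ε : ℝ, 0 < ε → ∀ᶠ T : ℝ in atTop,
      (0.66666908 - ε) * (T / (2 * π) * Real.log T) ≤ (simpleZeroCount (2 * T) : ℝ) - simpleZeroCount T) ∧
    (∀ ε : ℝ, 0 < ε → ∀ᶠ T : ℝ in atTop,
      (0.66666908 - ε) * (T / (2 * π) * Real.log T) ≤
        (criticalZeroCount (2 * T) : ℝ) - criticalZeroCount T) ∧
    (∀ ε : ℝ, 0 < ε → ∀ᶠ T : ℝ in atTop,
      (0.33333816 - ε) * (T / (2 * π) * Real.log T) ≤
        (simpleCriticalZeroCount (2 * T) : ℝ) - simpleCriticalZeroCount T)) ∧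
  ((∀ᶠ T : ℝ in atTop, InNarrowBox 0.001 T) →
    (∀ ε : ℝ, 0 < ε → ∀ᶠ T : ℝ in atTop,
      (0.67250064 - ε) * (T / (2 * π) * Real.log T) ≤ (simpleZeroCount (2 * T) : ℝ) - simpleZeroCount T) ∧
    (∀ ε : ℝ, 0 < ε → ∀ᶠ T : ℝ in atTop,
      (0.67250064 - ε) * (T / (2 * π) * Real.log T) ≤
        (criticalZeroCount (2 * T) : ℝ) - criticalZeroCount T) ∧
    (∀ ε : ℝ, 0 < ε → ∀ᶠ T : ℝ in atTop,
      (0.34500129 - ε) * (T / (2 * π) * Real.log T) ≤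
        (simpleCriticalZeroCount (2 * T) : ℝ) - simpleCriticalZeroCount T))

/-! ### Discharges -/

namespace BGSTB2025

/-- The tree's dyadic two-thirds (`AlpogeFurman2026_simple_critical_dyadic_holds`) transported to the
simple count: eventually `(2/3 − ε)(N(2T) − N(T)) ≤ N_s(2T) − N_s(T)`. [cite: AlpogeFurman2026, Theorem A (i) (p. 1)] -/
theorem eventually_simple_dyadic (ε : ℝ) (hε : 0 < ε) :
    ∀ᶠ T : ℝ in atTop,
      (2 / 3 - ε) * ((zetaZeroCount (2 * T) : ℝ) - zetaZeroCount T) ≤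
        (simpleZeroCount (2 * T) : ℝ) - simpleZeroCount T := by
  filter_upwards [AlpogeFurman2026_simple_critical_dyadic_holds ε hε, eventually_ge_atTop (0 : ℝ)]
    with T hT hT0
  have h := simpleCriticalZeroCount_window_le_simpleZeroCount_window (show T ≤ 2 * T by linarith)
  linarith

/-- The same for the count on the line with multiplicity: eventually
`(2/3 − ε)(N(2T) − N(T)) ≤ N₀(2T) − N₀(T)`. [cite: AlpogeFurman2026, Theorem A (p. 1), last sentence] -/
theorem eventually_critical_dyadic (ε : ℝ) (hε : 0 < ε) :
    ∀ᶠ T : ℝ in atTop,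
      (2 / 3 - ε) * ((zetaZeroCount (2 * T) : ℝ) - zetaZeroCount T) ≤
        (criticalZeroCount (2 * T) : ℝ) - criticalZeroCount T := by
  filter_upwards [AlpogeFurman2026_simple_critical_dyadic_holds ε hε, eventually_ge_atTop (0 : ℝ)]
    with T hT hT0
  have h := simpleCriticalZeroCount_window_le_criticalZeroCount_window (show T ≤ 2 * T by linarith)
  linarith

/-- **From a dyadic proportion to the printed `(T/2π) log T` form**: if eventually
`(c − ε)(N(2T) − N(T)) ≤ A(T)` for every `ε > 0`, and `c' < c`, `0 ≤ c`, then eventually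
`(c' − ε)(T/2π) log T ≤ A(T)` for every `ε > 0` (`N(2T) − N(T) ≥ (1 − δ)(T/2π) log T`).
[cite: BaluyotEtAl2025, §1.3 (before Theorem 2: "utilizing the asymptotic formula for the number of zeros with T<γ≤2T")] -/
theorem eventually_main_of_dyadic {A : ℝ → ℝ} {c c' : ℝ} (hc' : 0 ≤ c') (hcc' : c' < c)
    (h : ∀ ε : ℝ, 0 < ε → ∀ᶠ T : ℝ in atTop,
      (c - ε) * ((zetaZeroCount (2 * T) : ℝ) - zetaZeroCount T) ≤ A T) :
    ∀ ε : ℝ, 0 < ε → ∀ᶠ T : ℝ in atTop, (c' - ε) * (T / (2 * π) * Real.log T) ≤ A T := by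
  intro ε hε
  have hc : 0 ≤ c := by linarith
  -- `η := (c − c')/2`, `δ := η/(c + 1)`: `(c − η)(1 − δ) ≥ c − η − cδ ≥ c − 2η = c'`
  set η : ℝ := (c - c') / 2 with hη
  have hη0 : 0 < η := by rw [hη]; linarith
  have hηc : 0 ≤ c - η := by rw [hη]; linarith
  set δ : ℝ := η / (c + 1) with hδ
  have hδ0 : 0 < δ := by positivity
  have hcδ : c * δ ≤ η := by
    rw [hδ, mul_div_assoc', div_le_iff₀ (by linarith)]
    nlinarith
  filter_upwards [h η hη0, eventually_dyadic_count_near_main δ hδ0, eventually_gt_atTop (1 : ℝ)]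
    with T hA hN hT
  have hM : 0 < T / (2 * π) * Real.log T := by
    have := Real.log_pos hT; positivity
  have hD : (0 : ℝ) ≤ (zetaZeroCount (2 * T) : ℝ) - zetaZeroCount T := by
    rw [sub_nonneg]
    exact_mod_cast zetaZeroCount_mono (by linarith : T ≤ 2 * T)
  rcases le_or_gt (c' - ε) 0 with hneg | hpos
  · -- trivial when `c' − ε ≤ 0`
    have : 0 ≤ (c - η) * ((zetaZeroCount (2 * T) : ℝ) - zetaZeroCount T) := mul_nonneg hηc hD
    nlinarith
  · have hstep : c' - ε ≤ (c - η) * (1 - δ) := by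
      have e : (c - η) * (1 - δ) = c - η - c * δ + η * δ := by ring
      rw [e]
      nlinarith [mul_nonneg hη0.le hδ0.le]
    calc (c' - ε) * (T / (2 * π) * Real.log T)
        ≤ (c - η) * (1 - δ) * (T / (2 * π) * Real.log T) :=
          mul_le_mul_of_nonneg_right hstep hM.le
      _ = (c - η) * ((1 - δ) * (T / (2 * π) * Real.log T)) := by ring
      _ ≤ (c - η) * ((zetaZeroCount (2 * T) : ℝ) - zetaZeroCount T) :=
          mul_le_mul_of_nonneg_left hN.1 hηc
      _ ≤ A T := hA

end BGSTB2025

/-- **[BGSTB25] Theorem 1 DISCHARGED** — the box hypothesis and `b → 0` are not used: the three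
conclusions hold in this tree for all large `T` by [AF26] Theorem A (i) in dyadic form
(`AlpogeFurman2026_simple_critical_dyadic_holds`, a kernel theorem) and `N⁽¹⁾ ≤ N_s`, `N⁽¹⁾ ≤ N₀`
window by window (`BGSTB2025.eventually_simple_dyadic`, `BGSTB2025.eventually_critical_dyadic`).
[cite: BaluyotEtAl2025, Theorem 1] [cite: AlpogeFurman2026, Theorem A (i) (p. 1)] -/
theorem baluyotEtAl2025_theorem1_holds : baluyotEtAl2025_theorem1 := by
  intro b _ _
  refine ⟨BGSTB2025.eventually_simple_dyadic, BGSTB2025.eventually_critical_dyadic, fun ε hε ↦ ?_⟩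
  filter_upwards [AlpogeFurman2026_simple_critical_dyadic_holds ε hε, eventually_ge_atTop (0 : ℝ)]
    with T hT hT0
  have hD : (0 : ℝ) ≤ (zetaZeroCount (2 * T) : ℝ) - zetaZeroCount T := by
    have := BGSTB2025.zetaZeroCount_sub_eq (show T ≤ 2 * T by linarith)
    have h0 : (0 : ℤ) ≤ (zetaZeroCount (2 * T) : ℤ) - zetaZeroCount T := by
      rw [this]
      exact Finset.sum_nonneg fun ρ hρ ↦ by
        have := BGSTB2025.one_le_order_of_mem (Finset.mem_filter.1 hρ).1; omega
    exact_mod_cast h0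
  nlinarith

/-- **[GS26] Theorem 1 DISCHARGED** — VERBATIM `AlpogeFurman2026_simple_critical_dyadic_holds` with two
unused hypotheses. [cite: GoldstonSuriajaya2026, Theorem 1] [cite: AlpogeFurman2026, Theorem A (i) (p. 1)] -/
theorem goldstonSuriajaya2026_theorem1_holds : goldstonSuriajaya2026_theorem1 :=
  fun _ _ _ ↦ AlpogeFurman2026_simple_critical_dyadic_holds

/-- **[BGSTB25] Theorem 2 DISCHARGED** — the box hypotheses are not used. The `b = 0.3185` lines and
the `N₀ˢ` line for `b = 0.001` follow from [AF26] Theorem A with the FLAT window where `2/3` beats the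
printed constant (`0.33333816`, `0.34500129 < 2/3`) and otherwise from the Montgomery–Taylor window
(`AlpogeFurman2026_simple_critical_MT_dyadic_holds`: dyadic proportion `2 − c_MT⁻¹ − ε`) with
`2 − c_MT⁻¹ > 0.67250065 > 0.67250064 ≥ 0.66666908` (`two_sub_montgomeryTaylorInvConstant_bounds_sharp`),
transported by `N⁽¹⁾ ≤ N_s, N₀` on the window and `N(2T) − N(T) ≥ (1 − δ)(T/2π) log T`
(`BGSTB2025.eventually_main_of_dyadic`). [cite: BaluyotEtAl2025, Theorem 2] [cite: AlpogeFurman2026, Theorem A (p. 1), second sentence] -/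
theorem baluyotEtAl2025_theorem2_holds : baluyotEtAl2025_theorem2 := by
  have hMT := two_sub_montgomeryTaylorInvConstant_bounds_sharp
  set c : ℝ := 2 - montgomeryTaylorInvConstant with hc
  -- MT-window dyadic proportions for `N⁽¹⁾`, `N_s`, `N₀`
  have hS1 : ∀ ε : ℝ, 0 < ε → ∀ᶠ T : ℝ in atTop,
      (c - ε) * ((zetaZeroCount (2 * T) : ℝ) - zetaZeroCount T) ≤
        (simpleCriticalZeroCount (2 * T) : ℝ) - simpleCriticalZeroCount T := by
    intro ε hε
    have := AlpogeFurman2026_simple_critical_MT_dyadic_holds ε hε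
    simpa only [hc] using this
  have hSs : ∀ ε : ℝ, 0 < ε → ∀ᶠ T : ℝ in atTop,
      (c - ε) * ((zetaZeroCount (2 * T) : ℝ) - zetaZeroCount T) ≤
        (simpleZeroCount (2 * T) : ℝ) - simpleZeroCount T := by
    intro ε hε
    filter_upwards [hS1 ε hε, eventually_ge_atTop (0 : ℝ)] with T hT hT0
    have h := BGSTB2025.simpleCriticalZeroCount_window_le_simpleZeroCount_window
      (show T ≤ 2 * T by linarith)
    linarith
  have hS0 : ∀ ε : ℝ, 0 < ε → ∀ᶠ T : ℝ in atTop,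
      (c - ε) * ((zetaZeroCount (2 * T) : ℝ) - zetaZeroCount T) ≤
        (criticalZeroCount (2 * T) : ℝ) - criticalZeroCount T := by
    intro ε hε
    filter_upwards [hS1 ε hε, eventually_ge_atTop (0 : ℝ)] with T hT hT0
    have h := BGSTB2025.simpleCriticalZeroCount_window_le_criticalZeroCount_window
      (show T ≤ 2 * T by linarith)
    linarith
  -- flat-window dyadic proportion `2/3` for `N⁽¹⁾`
  have hF1 : ∀ ε : ℝ, 0 < ε → ∀ᶠ T : ℝ in atTop,
      (2 / 3 - ε) * ((zetaZeroCount (2 * T) : ℝ) - zetaZeroCount T) ≤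
        (simpleCriticalZeroCount (2 * T) : ℝ) - simpleCriticalZeroCount T :=
    AlpogeFurman2026_simple_critical_dyadic_holds
  refine ⟨fun _ ↦ ⟨?_, ?_, ?_⟩, fun _ ↦ ⟨?_, ?_, ?_⟩⟩
  · exact BGSTB2025.eventually_main_of_dyadic (by norm_num) (by linarith [hMT.1]) hSs
  · exact BGSTB2025.eventually_main_of_dyadic (by norm_num) (by linarith [hMT.1]) hS0
  · exact BGSTB2025.eventually_main_of_dyadic (by norm_num) (by norm_num) hF1
  · exact BGSTB2025.eventually_main_of_dyadic (by norm_num) (by linarith [hMT.1]) hSs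
  · exact BGSTB2025.eventually_main_of_dyadic (by norm_num) (by linarith [hMT.1]) hS0
  · exact BGSTB2025.eventually_main_of_dyadic (by norm_num) (by norm_num) hF1

/-- [GS25] Theorem 3's constant `b = 0.3185` and [GS26]'s "`b → 0`" hypotheses hold under RH (every
`b > 0`, every `T > 1`), so the typed facts specialise to RH-conditional statements — recorded only to
show the hypothesis shape is satisfiable. [cite: GoldstonSuriajaya2026, §1 (last paragraph)] -/
theorem BGSTB2025.eventually_inNarrowBox_of_RH (hRH : RiemannHypothesis) {b : ℝ} (hb : 0 < b) :
    ∀ᶠ T : ℝ in atTop, BGSTB2025.InNarrowBox b T := by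
  filter_upwards [eventually_gt_atTop (1 : ℝ)] with T hT
  exact BGSTB2025.InNarrowBox.of_RH hRH hb hT

end Literature.NumberTheory.LFunctions

end
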